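import Literature.MathematicalPhysics.QuantumLattice.DWaveSourceNNNHoppingWindowCertificate
import Literature.MathematicalPhysics.QuantumManyBody.StateRelaxationKKT
import HarnessLib

/-!
# Window certificates WITH a state-optimality (KKT) block for the pair-sourced `t–t'` Hubbard tori,
# read in the orbit state of every `S^z`-eigenvector GROUND state (uniform in `L`)

Topic `MathematicalPhysics/QuantumLattice`, family `hubbard`. Sequel of
`DWaveSourceNNNHoppingWindowCertificate.lean` (`re_orbitState_ge_of_sourced_window_certificate_d4_TT'_ineq`:
ONE identity in the window CAR algebra `𝔄_{Λ'}` — SOS + commutators with the sourced window Hamiltonian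
`H^{src,tt'}_{Λ'} = pairSourceWindowHamiltonianTT'` + affine-`D₄` defects + `S^z`-charged words + anti-Hermitian
parts + residual words, with an energy constraint `κ (u·1 − E^{src,tt'})` — bounds `Re ω̄_ψ(Γ(ι_{Λ',L}) X)` for
every unit `S^z`-eigenvector EIGENSTATE `ψ` of `A_L = dWaveSourceTorusTT' L tp U μ h`). That row knows nothing
specific to GROUND states. The state-optimality ("KKT", second-order perturbative positivity) summand

  `kktForm H^{src,tt'}_{Λ'} G B̃ = Σ_ab G_ab • (B̃_aᴴ (H^{src,tt'}_{Λ'} B̃_b − B̃_b H^{src,tt'}_{Λ'}))`,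
  `G ⪰ 0`, `B̃_b = Γ(incl) B_b`, `B_b ∈ 𝔄_Λ` supported in the inner region (`thicken Λ 1 ⊆ Λ'`),

is a nonnegative residual in the orbit state of a GROUND state (Bratteli–Robinson II Prop. 5.3.19;
Araújo–Klep–Garner–Vértesi–Navascués Prop. 11; Wang et al. 2024 §III). THE POINT FOR THE PINNING FIELD
(cell `hubbard-cq`, card `sourced-kkt-one-point-floor`): the ground state of the sourced problem is taken on
the FULL Fock space (`Matrix.groundEnergy`; the particle number is not conserved, `S^z` merely labels the
degenerate multiplet), so it is a GLOBAL ground state and the ground-state inequality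
`Re ω̄_ψ(Cᴴ [A_L, C]) ≥ 0` holds for EVERY window generator `C` — charged (`c`, `c c`, …), odd, spinful — with
NO conservation hypothesis on the generators (contrast `HubbardLadder/KKTWindowRowsTTPrime`, sector ground
states of the conserving model, where `B_b` must conserve `N̂` and `S^z`).

* §1 (generic, finite-dimensional): for Hermitian `A`, a finite family `T_g` commuting with `A`, and a
  vector `ψ` with `A ψ = E₀ ψ` (`E₀ = groundEnergy A`): `0 ≤ Re ω̄_ψ(Cᴴ (A C − C A))` for EVERY `C`
  (`re_orbitState_conjTranspose_mul_commutator_nonneg_of_groundState`: every orbit vector `T_gᴴ ψ` is a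
  global ground vector; `minEnergyOn_top`) and `0 ≤ Re ω̄_ψ(kktForm A G B)` for `G ⪰ 0`, ANY `B`
  (`re_orbitState_kktForm_nonneg_of_groundState`, weak duality `re_map_kktForm_nonneg`).
* §2 (the sourced `t–t'` tori): the pulled-back window KKT element is nonnegative in `ω̄_ψ` for every ground
  vector `ψ` of `A_L` (`re_orbitState_fermionEmbed_kktForm_sourced_TT'_nonneg`; locality
  `dWaveSourceTorusTT'_commutator_fermionEmbed`, symmetry `spaceGroupUnitary_mul_dWaveSourceTorusTT'`). Rows:
  `re_orbitState_ge_of_sourced_window_certificate_d4_TT'_kkt_ineq` (the identity of the eigenstate row with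
  `+ kktForm H^{src,tt'}_{Λ'} G (Γ(incl) ∘ B)` on the right ⇒ for every `L ≥ 3`, every real `M`, every unit
  `ψ ∈ fockSpinZSector M` with `A_L ψ = E₀ ψ`: `c − Σₖ ‖aₖ‖ + κ (u − E₀/L²) ≤ Re ω̄_ψ(Γ(ι_{Λ',L}) X)`),
  `…_kkt_of_energy_le` (`κ ≥ 0`, `E₀/L² ≤ u` ⇒ `c − Σₖ ‖aₖ‖ ≤ …`: the ground-state cell
  `Summit.Ventures.CertifiedManyBodySolver.SourcedTorusCorrLowerRowGS` given an energy ceiling cell) and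
  `…_kkt` (no energy constraint in the identity ⇒ `c − Σₖ ‖aₖ‖ ≤ …` for every ground state, NO cap row — the
  shape of a one-point MIN program with KKT rows only).

Validity, exactly as proved: finite tori `L ≥ 3` with `x ↦ x mod L` injective on `thicken Λ' 1`; labels
`S ∋ 1` closed under products with `χ_{B₁g} = 1` (the quarter turn maps `h ↦ −h`); `G ⪰ 0`; GROUND states
(an excited eigenvector violates the block). HONEST SCOPE: soundness only — no certificate is constructed or
claimed; a bound at fixed `h > 0` says nothing about `d`-wave order of the Hubbard model. Everything is PROVED;
no definition, no named fact.

References: [cite: BratteliRobinsonII1997, Prop. 5.3.19] [cite: AraujoEtAl2023, §3.2 Prop. 11]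
[cite: WangEtAl2024, §III] [cite: Han2020Bootstrap, §3] [cite: KomaTasaki1994, §1]
-/
noncomputable section

namespace Literature.MathematicalPhysics.QuantumLattice

open Matrix Finset HubbardWave0 Literature.Probability.LatticeModels
open Literature.MathematicalPhysics.QuantumManyBody.StateRelaxation
open scoped ComplexOrder BigOperators

/-! ## §1 Orbit states of GLOBAL ground states: the ground-state inequality for every generator -/

section OrbitGroundState

variable {n : Type*} [Fintype n] [DecidableEq n] {Gp : Type*} [Fintype Gp]
variable {m : Type*} [Fintype m] [DecidableEq m]

/-- **The ground-state inequality in the orbit state of a global ground state, EVERY generator.** `A`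
Hermitian, `T_g` a finite family with `T_g A = A T_g`, `ψ` with `A ψ = E₀ ψ` (`E₀ = groundEnergy A`), and ANY
matrix `C`: `0 ≤ Re ω̄_ψ(Cᴴ (A C − C A))`, `ω̄_ψ = orbitState T ψ` — every orbit vector `T_gᴴ ψ` satisfies
`A T_gᴴ ψ = E₀ T_gᴴ ψ`, `E₀ = minEnergyOn A ⊤`, and the vector inequality `⟨Cφ, (A − E₀) Cφ⟩ ≥ 0`
(Bratteli–Robinson II Prop. 5.3.19, `(1) ⇒ (2)`) is averaged. [cite: BratteliRobinsonII1997, Prop. 5.3.19] -/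
theorem re_orbitState_conjTranspose_mul_commutator_nonneg_of_groundState [Nonempty n] {A C : Matrix n n ℂ}
    (hA : A.IsHermitian) {T : Gp → Matrix n n ℂ} (hTA : ∀ g, T g * A = A * T g) {ψ : n → ℂ}
    (hAψ : A *ᵥ ψ = ((A.groundEnergy : ℝ) : ℂ) • ψ) :
    0 ≤ (orbitState T ψ (Cᴴ * (A * C - C * A))).re := by
  have hg : ∀ g, A *ᵥ ((T g)ᴴ *ᵥ ψ) = ((A.minEnergyOn ⊤ : ℝ) : ℂ) • ((T g)ᴴ *ᵥ ψ) := fun g => by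
    have hc : A * (T g)ᴴ = (T g)ᴴ * A := (conjTranspose_commute_of_commute hA (hTA g)).symm
    rw [mulVec_mulVec, hc, ← mulVec_mulVec, hAψ, mulVec_smul, Matrix.minEnergyOn_top_holds hA]
  rw [orbitState_apply, ← Complex.ofReal_natCast, ← Complex.ofReal_inv, Complex.re_ofReal_mul,
    Complex.re_sum]
  exact mul_nonneg (inv_nonneg.2 (Nat.cast_nonneg _)) (Finset.sum_nonneg fun g _ => by
    rw [Literature.MathematicalPhysics.QuantumManyBody.StateRelaxation.vectorState_apply]
    exact re_expect_conjTranspose_mul_commutator_nonneg_of_sectorGS hA ⊤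
      (fun w _ => Submodule.mem_top) Submodule.mem_top (hg g))

/-- **KKT block ⇒ nonnegative in the orbit state of a global ground state, ANY generators.** Under the
hypotheses of `re_orbitState_conjTranspose_mul_commutator_nonneg_of_groundState`, for a multiplier `G ⪰ 0`
and an arbitrary finite generator family `B`: `0 ≤ Re ω̄_ψ(kktForm A G B)` (factor `G = Lᴴ L`,
`re_map_kktForm_nonneg`). [cite: AraujoEtAl2023, §3.2 Prop. 11] [cite: BratteliRobinsonII1997, Prop. 5.3.19] -/
theorem re_orbitState_kktForm_nonneg_of_groundState [Nonempty n] {A : Matrix n n ℂ} (hA : A.IsHermitian)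
    {T : Gp → Matrix n n ℂ} (hTA : ∀ g, T g * A = A * T g) {ψ : n → ℂ}
    (hAψ : A *ᵥ ψ = ((A.groundEnergy : ℝ) : ℂ) • ψ) {Gm : Matrix m m ℂ} (hG : Gm.PosSemidef)
    (B : m → Matrix n n ℂ) :
    0 ≤ (orbitState T ψ (kktForm A Gm B)).re :=
  re_map_kktForm_nonneg _ A hG B fun c => by
    rw [Matrix.star_eq_conjTranspose]
    exact re_orbitState_conjTranspose_mul_commutator_nonneg_of_groundState hA hTA hAψ

end OrbitGroundState

/-! ## §2 The pair-sourced `t–t'` tori: window rows with a KKT summand, every `S^z`-eigenvector ground state -/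

section TorusSourced

variable {L : ℕ} [NeZero L]

/-- (Local to this section, as in `DWaveSourceNNNHoppingWindowCertificate`.) [folklore] -/
local instance (priority := high) instDecidableEqFermionTorusSrcTTKKT : DecidableEq (FermionTorus 2 L) :=
  LinearOrder.toDecidableEq

/-- Moving a summand of the right-hand side of a certificate identity into the objective:
`X − c − K = R + k ⇒ (X − k) − c − K = R`. [folklore] -/
private theorem cert_sub_kkt_src {A : Type*} [AddCommGroup A] {X c K R k : A}
    (h : X - c - K = R + k) : X - k - c - K = R := by
  rw [eq_sub_of_add_eq h.symm]
  abel

/-- **The sourced window KKT element is nonnegative in the orbit state of every ground vector of the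
pair-sourced `t–t'` torus — for ARBITRARY window generators.** Regions `Λ ⊆ Λ'` with `thicken Λ 1 ⊆ Λ'`,
`x ↦ x mod L` injective on `thicken Λ' 1`; generators `B_b ∈ 𝔄_Λ` (no conservation hypothesis: charged, odd,
spinful words allowed); `G ⪰ 0`; labels `S ⊆ ker χ_{B₁g}`; `ψ` with `A_L ψ = E₀ ψ`. Then
`0 ≤ Re ω̄_ψ(Γ(ι_{Λ',L}) kktForm H^{src,tt'}_{Λ'} G (Γ(incl) ∘ B))`, `ω̄_ψ = orbitState (U_w D_γ) ψ`
(`dWaveSourceTorusTT'_commutator_fermionEmbed`: `Γ(H^{src,tt'}_{Λ'} B̃ − B̃ H^{src,tt'}_{Λ'}) = A_L ΓB̃ − ΓB̃ A_L`;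
`U_w D_γ` commute with `A_L`, `spaceGroupUnitary_mul_dWaveSourceTorusTT'`).
[cite: BratteliRobinsonII1997, Prop. 5.3.19] [cite: AraujoEtAl2023, §3.2 Prop. 11] -/
theorem re_orbitState_fermionEmbed_kktForm_sourced_TT'_nonneg (tp U μ h : ℝ)
    {Λ Λ' : Finset (Site 2)} (hΛ : Λ ⊆ Λ') (h8 : thicken Λ 1 ⊆ Λ')
    (hInj : Set.InjOn (Torus.proj (d := 2) L) ↑(thicken Λ' 1))
    (hInj' : Set.InjOn (Torus.proj (d := 2) L) ↑Λ')
    {S : Finset (DihedralGroup 4)} (hS : ∀ γ ∈ S, b1gChar γ = 1)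
    {ψ : Fock (Orb (FermionTorus 2 L))}
    (hHψ : dWaveSourceTorusTT' L tp U μ h *ᵥ ψ =
      (((dWaveSourceTorusTT' L tp U μ h).groundEnergy : ℝ) : ℂ) • ψ)
    {β : Type*} [Fintype β] [DecidableEq β] {G : Matrix β β ℂ} (hG : G.PosSemidef)
    (Bk : β → FermionOp Λ) :
    0 ≤ (orbitState (spaceGroupUnitary S) ψ
        (fermionEmbed (PolySite.toTorusEmb L hInj')
          (kktForm (pairSourceWindowHamiltonianTT' dWaveFormFactor Λ' tp U μ h) G
            (fun b => fermionEmbed (PolySite.incl hΛ) (Bk b))))).re := by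
  have hH : (dWaveSourceTorusTT' L tp U μ h).IsHermitian := dWaveSourceTorusTT'_isHermitian L tp U μ h
  set ω' : FermionOp Λ' →ₗ[ℂ] ℂ :=
    orbitState (spaceGroupUnitary S) ψ ∘ₗ (fermionEmbed (PolySite.toTorusEmb L hInj')).toLinearMap
    with hω'
  have hω'app : ∀ x, ω' x = orbitState (spaceGroupUnitary S) ψ
      (fermionEmbed (PolySite.toTorusEmb L hInj') x) := fun _ => rfl
  have hk := re_map_kktForm_nonneg ω' (pairSourceWindowHamiltonianTT' dWaveFormFactor Λ' tp U μ h)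
    hG (fun b => fermionEmbed (PolySite.incl hΛ) (Bk b)) fun wc => ?_
  · rwa [hω'app] at hk
  -- the ground-state inequality for the generator `C = Γ(Σ_b wc_b B_b)` — no sector to preserve
  have hsum : ∑ j, wc j • fermionEmbed (PolySite.incl hΛ) (Bk j) =
      fermionEmbed (PolySite.incl hΛ) (∑ j, wc j • Bk j) := by
    rw [fermionEmbed_sum]
    exact Finset.sum_congr rfl fun j _ => (fermionEmbed_smul _ _ _).symm
  rw [hsum, hω'app, Matrix.star_eq_conjTranspose, fermionEmbed_mul, fermionEmbed_conjTranspose,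
    ← dWaveSourceTorusTT'_commutator_fermionEmbed L hΛ h8 hInj tp U μ h (∑ j, wc j • Bk j)]
  exact re_orbitState_conjTranspose_mul_commutator_nonneg_of_groundState hH
    (fun g => spaceGroupUnitary_mul_dWaveSourceTorusTT' hS tp U μ h g) hHψ

/-- **Sourced `t–t'` window certificate with energy constraint, affine `D₄` reductions AND a KKT block ⇒
space-group-averaged expectation of a local observable in every `S^z`-eigenvector GROUND state of every large
pair-sourced torus.** Data as in `re_orbitState_ge_of_sourced_window_certificate_d4_TT'_ineq` plus a multiplier
`G ⪰ 0` and ARBITRARY generators `B_b ∈ 𝔄_Λ`; the identity in `𝔄_{Λ'}` carries the extra summand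
`+ kktForm H^{src,tt'}_{Λ'} G (Γ(incl) ∘ B)` on the right. Then for every `L ≥ 3` with `x ↦ x mod L` injective on
`thicken Λ' 1`, every real `M`, every finite `S ∋ 1` closed under multiplication with `χ_{B₁g} = 1` on `S` and
`γₗ ∈ S`, and every unit `ψ ∈ fockSpinZSector M` with `A_L ψ = E₀ ψ` (`E₀ = groundEnergy A_L`, full Fock
space): `c − Σₖ ‖aₖ‖ + κ (u − E₀/L²) ≤ Re ω̄_ψ(Γ(ι_{Λ',L}) X)`. (The eigenstate row for the objective
`X − kktForm …`, plus `re_orbitState_fermionEmbed_kktForm_sourced_TT'_nonneg`.) [cite: WangEtAl2024, §III]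
[cite: AraujoEtAl2023, §3.2 Prop. 11] -/
theorem re_orbitState_ge_of_sourced_window_certificate_d4_TT'_kkt_ineq (tp U μ h : ℝ) (hL : 3 ≤ L) {M : ℝ}
    {Λ Λ' : Finset (Site 2)} (hΛ : Λ ⊆ Λ') (h8 : thicken Λ 1 ⊆ Λ')
    (h0 : thicken ({0} : Finset (Site 2)) 1 ⊆ Λ') (hz : (0 : Site 2) ∈ Λ')
    (hP : pairRegion (insert (0 : Site 2) unitSteps) 0 ⊆ Λ')
    (hInj : Set.InjOn (Torus.proj (d := 2) L) ↑(thicken Λ' 1))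
    (hInj' : Set.InjOn (Torus.proj (d := 2) L) ↑Λ')
    {S : Finset (DihedralGroup 4)} (h1 : (1 : DihedralGroup 4) ∈ S) (hmul : ∀ a ∈ S, ∀ b ∈ S, a * b ∈ S)
    (hS : ∀ γ ∈ S, b1gChar γ = 1)
    {ψ : Fock (Orb (FermionTorus 2 L))} (hψK : ψ ∈ fockSpinZSector (Λ := FermionTorus 2 L) M)
    (hψ1 : star ψ ⬝ᵥ ψ = 1)
    (hHψ : dWaveSourceTorusTT' L tp U μ h *ᵥ ψ =
      (((dWaveSourceTorusTT' L tp U μ h).groundEnergy : ℝ) : ℂ) • ψ)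
    (Xw : FermionOp Λ') (κ u : ℝ)
    {m : Type*} [Fintype m] [DecidableEq m] {Λm : Matrix m m ℂ} (hΛm : Λm.PosSemidef)
    (O : m → FermionOp Λ')
    {κ' : Type*} (s : Finset κ') (B : κ' → FermionOp Λ)
    {ι : Type*} (tt : Finset ι) (γ : ι → DihedralGroup 4) (hγS : ∀ l ∈ tt, γ l ∈ S) (wv : ι → Site 2)
    (hsh : ∀ l, d4ShiftSet (γ l) (wv l) Λ ⊆ Λ') (Y : ι → FermionOp Λ)
    {ρ : Type*} (uu : Finset ρ) (b : ρ → ℂ) (cw : ρ → List (Orb (PolySite Λ') × Bool))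
    (hcw : ∀ j ∈ uu, ladderSpinCharge (cw j) ≠ 0)
    {δ : Type*} (ah : Finset δ) (dc : δ → ℝ) (V : δ → FermionOp Λ')
    {κ'' : Type*} (w : Finset κ'') (a : κ'' → ℂ) (word : κ'' → List (Orb (PolySite Λ') × Bool))
    {β : Type*} [Fintype β] [DecidableEq β] {G : Matrix β β ℂ} (hG : G.PosSemidef)
    (Bk : β → FermionOp Λ) {c : ℝ}
    (hcert : Xw - (c : ℂ) • (1 : FermionOp Λ') -
        ((κ : ℝ) : ℂ) • (((u : ℝ) : ℂ) • (1 : FermionOp Λ') -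
          (fermionEmbed (PolySite.incl h0) ((hubbardTTPrimeFermionInteraction 1 tp U).meanEnergyObs 1) -
            (μ : ℂ) • ∑ σ : Fin 2, nAt 0 hz σ -
            (h : ℂ) • (fermionEmbed (PolySite.incl hP) (localPairAt (insert (0 : Site 2) unitSteps) dWaveFormFactor 0) +
              (fermionEmbed (PolySite.incl hP) (localPairAt (insert (0 : Site 2) unitSteps) dWaveFormFactor 0))ᴴ))) =
      gramForm Λm O +
        (∑ k ∈ s, (pairSourceWindowHamiltonianTT' dWaveFormFactor Λ' tp U μ h * fermionEmbed (PolySite.incl hΛ) (B k) -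
            fermionEmbed (PolySite.incl hΛ) (B k) * pairSourceWindowHamiltonianTT' dWaveFormFactor Λ' tp U μ h) +
          ∑ l ∈ tt, (fermionEmbed (PolySite.incl (hsh l)) (fermionEmbed (PolySite.d4Emb (γ l) (wv l) Λ) (Y l)) -
            fermionEmbed (PolySite.incl hΛ) (Y l)) +
          ∑ j ∈ uu, b j • ladderWord (cw j)) +
        (∑ m' ∈ ah, ((dc m' : ℝ) : ℂ) • ((V m')ᴴ - V m') + ∑ k ∈ w, a k • ladderWord (word k)) +
        kktForm (pairSourceWindowHamiltonianTT' dWaveFormFactor Λ' tp U μ h) G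
          (fun b' => fermionEmbed (PolySite.incl hΛ) (Bk b'))) :
    c - ∑ k ∈ w, ‖a k‖ + κ * (u - (dWaveSourceTorusTT' L tp U μ h).groundEnergy / (L : ℝ) ^ 2) ≤
      (orbitState (spaceGroupUnitary S) ψ (fermionEmbed (PolySite.toTorusEmb L hInj') Xw)).re := by
  -- the eigenstate row WITHOUT the block, for the objective `X − kktForm …`
  have hmain := re_orbitState_ge_of_sourced_window_certificate_d4_TT'_ineq tp U μ h hL hΛ h8 h0 hz hP hInj hInj'
    h1 hmul hS hψK hψ1 hHψ
    (Xw - kktForm (pairSourceWindowHamiltonianTT' dWaveFormFactor Λ' tp U μ h) G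
      (fun b' => fermionEmbed (PolySite.incl hΛ) (Bk b'))) κ u hΛm O s B tt γ hγS wv hsh Y uu b cw hcw ah dc V w a
    word (cert_sub_kkt_src hcert)
  -- the block is a nonnegative residual in the orbit state of the ground state
  have hkkt := re_orbitState_fermionEmbed_kktForm_sourced_TT'_nonneg tp U μ h hΛ h8 hInj hInj' hS hHψ hG Bk
  rw [map_sub, map_sub, Complex.sub_re] at hmain
  linarith

/-- **For every ground state, with the energy hypothesis** (`κ ≥ 0`, a certified ceiling `E₀/L² ≤ u`): under
the hypotheses of `re_orbitState_ge_of_sourced_window_certificate_d4_TT'_kkt_ineq`, EVERY unit `S^z`-eigenvector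
ground vector `ψ` of the pair-sourced torus — every vector of a degenerate ground multiplet — obeys
`c − Σₖ ‖aₖ‖ ≤ Re ω̄_ψ(Γ(ι_{Λ',L}) X)`, uniformly in `L`: the ground-state cell
`Summit.Ventures.CertifiedManyBodySolver.SourcedTorusCorrLowerRowGS` given an energy ceiling cell at `u`.
[cite: WangEtAl2024, §III] [cite: AraujoEtAl2023, §3.2 Prop. 11] -/
theorem re_orbitState_ge_of_sourced_window_certificate_d4_TT'_kkt_of_energy_le (tp U μ h : ℝ) (hL : 3 ≤ L)
    {M : ℝ} {Λ Λ' : Finset (Site 2)} (hΛ : Λ ⊆ Λ') (h8 : thicken Λ 1 ⊆ Λ')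
    (h0 : thicken ({0} : Finset (Site 2)) 1 ⊆ Λ') (hz : (0 : Site 2) ∈ Λ')
    (hP : pairRegion (insert (0 : Site 2) unitSteps) 0 ⊆ Λ')
    (hInj : Set.InjOn (Torus.proj (d := 2) L) ↑(thicken Λ' 1))
    (hInj' : Set.InjOn (Torus.proj (d := 2) L) ↑Λ')
    {S : Finset (DihedralGroup 4)} (h1 : (1 : DihedralGroup 4) ∈ S) (hmul : ∀ a ∈ S, ∀ b ∈ S, a * b ∈ S)
    (hS : ∀ γ ∈ S, b1gChar γ = 1)
    {ψ : Fock (Orb (FermionTorus 2 L))} (hψK : ψ ∈ fockSpinZSector (Λ := FermionTorus 2 L) M)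
    (hψ1 : star ψ ⬝ᵥ ψ = 1)
    (hHψ : dWaveSourceTorusTT' L tp U μ h *ᵥ ψ =
      (((dWaveSourceTorusTT' L tp U μ h).groundEnergy : ℝ) : ℂ) • ψ)
    (Xw : FermionOp Λ') {κ u : ℝ} (hκ : 0 ≤ κ)
    (hu : (dWaveSourceTorusTT' L tp U μ h).groundEnergy / (L : ℝ) ^ 2 ≤ u)
    {m : Type*} [Fintype m] [DecidableEq m] {Λm : Matrix m m ℂ} (hΛm : Λm.PosSemidef)
    (O : m → FermionOp Λ')
    {κ' : Type*} (s : Finset κ') (B : κ' → FermionOp Λ)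
    {ι : Type*} (tt : Finset ι) (γ : ι → DihedralGroup 4) (hγS : ∀ l ∈ tt, γ l ∈ S) (wv : ι → Site 2)
    (hsh : ∀ l, d4ShiftSet (γ l) (wv l) Λ ⊆ Λ') (Y : ι → FermionOp Λ)
    {ρ : Type*} (uu : Finset ρ) (b : ρ → ℂ) (cw : ρ → List (Orb (PolySite Λ') × Bool))
    (hcw : ∀ j ∈ uu, ladderSpinCharge (cw j) ≠ 0)
    {δ : Type*} (ah : Finset δ) (dc : δ → ℝ) (V : δ → FermionOp Λ')
    {κ'' : Type*} (w : Finset κ'') (a : κ'' → ℂ) (word : κ'' → List (Orb (PolySite Λ') × Bool))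
    {β : Type*} [Fintype β] [DecidableEq β] {G : Matrix β β ℂ} (hG : G.PosSemidef)
    (Bk : β → FermionOp Λ) {c : ℝ}
    (hcert : Xw - (c : ℂ) • (1 : FermionOp Λ') -
        ((κ : ℝ) : ℂ) • (((u : ℝ) : ℂ) • (1 : FermionOp Λ') -
          (fermionEmbed (PolySite.incl h0) ((hubbardTTPrimeFermionInteraction 1 tp U).meanEnergyObs 1) -
            (μ : ℂ) • ∑ σ : Fin 2, nAt 0 hz σ -
            (h : ℂ) • (fermionEmbed (PolySite.incl hP) (localPairAt (insert (0 : Site 2) unitSteps) dWaveFormFactor 0) +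
              (fermionEmbed (PolySite.incl hP) (localPairAt (insert (0 : Site 2) unitSteps) dWaveFormFactor 0))ᴴ))) =
      gramForm Λm O +
        (∑ k ∈ s, (pairSourceWindowHamiltonianTT' dWaveFormFactor Λ' tp U μ h * fermionEmbed (PolySite.incl hΛ) (B k) -
            fermionEmbed (PolySite.incl hΛ) (B k) * pairSourceWindowHamiltonianTT' dWaveFormFactor Λ' tp U μ h) +
          ∑ l ∈ tt, (fermionEmbed (PolySite.incl (hsh l)) (fermionEmbed (PolySite.d4Emb (γ l) (wv l) Λ) (Y l)) -
            fermionEmbed (PolySite.incl hΛ) (Y l)) +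
          ∑ j ∈ uu, b j • ladderWord (cw j)) +
        (∑ m' ∈ ah, ((dc m' : ℝ) : ℂ) • ((V m')ᴴ - V m') + ∑ k ∈ w, a k • ladderWord (word k)) +
        kktForm (pairSourceWindowHamiltonianTT' dWaveFormFactor Λ' tp U μ h) G
          (fun b' => fermionEmbed (PolySite.incl hΛ) (Bk b'))) :
    c - ∑ k ∈ w, ‖a k‖ ≤
      (orbitState (spaceGroupUnitary S) ψ (fermionEmbed (PolySite.toTorusEmb L hInj') Xw)).re := by
  have hmain := re_orbitState_ge_of_sourced_window_certificate_d4_TT'_kkt_ineq tp U μ h hL hΛ h8 h0 hz hP hInj hInj'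
    h1 hmul hS hψK hψ1 hHψ Xw κ u hΛm O s B tt γ hγS wv hsh Y uu b cw hcw ah dc V w a word hG Bk hcert
  have hslack : 0 ≤ κ * (u - (dWaveSourceTorusTT' L tp U μ h).groundEnergy / (L : ℝ) ^ 2) :=
    mul_nonneg hκ (sub_nonneg.2 hu)
  linarith

/-- **Ground-state rows only (no energy constraint in the identity).** The identity
`X − c·1 = SOS + Σ[H^{src,tt'}_{Λ'}, Γ(incl)Bₖ] + Σ(affine-D₄ defects) + Σ bⱼ wⱼ + Σ dₘ(Vₘᴴ − Vₘ) + Σ aₖ vₖ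
 + kktForm H^{src,tt'}_{Λ'} G (Γ(incl) ∘ B)` — the shape of a one-point MIN/MAX program whose only
ground-state-specific rows are KKT rows, NO cap row — gives `c − Σₖ ‖aₖ‖ ≤ Re ω̄_ψ(Γ(ι_{Λ',L}) X)` for every
unit `S^z`-eigenvector ground vector of every large pair-sourced torus. [cite: WangEtAl2024, §III]
[cite: AraujoEtAl2023, §3.2 Prop. 11] -/
theorem re_orbitState_ge_of_sourced_window_certificate_d4_TT'_kkt (tp U μ h : ℝ) (hL : 3 ≤ L)
    {M : ℝ} {Λ Λ' : Finset (Site 2)} (hΛ : Λ ⊆ Λ') (h8 : thicken Λ 1 ⊆ Λ')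
    (h0 : thicken ({0} : Finset (Site 2)) 1 ⊆ Λ') (hz : (0 : Site 2) ∈ Λ')
    (hP : pairRegion (insert (0 : Site 2) unitSteps) 0 ⊆ Λ')
    (hInj : Set.InjOn (Torus.proj (d := 2) L) ↑(thicken Λ' 1))
    (hInj' : Set.InjOn (Torus.proj (d := 2) L) ↑Λ')
    {S : Finset (DihedralGroup 4)} (h1 : (1 : DihedralGroup 4) ∈ S) (hmul : ∀ a ∈ S, ∀ b ∈ S, a * b ∈ S)
    (hS : ∀ γ ∈ S, b1gChar γ = 1)
    {ψ : Fock (Orb (FermionTorus 2 L))} (hψK : ψ ∈ fockSpinZSector (Λ := FermionTorus 2 L) M)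
    (hψ1 : star ψ ⬝ᵥ ψ = 1)
    (hHψ : dWaveSourceTorusTT' L tp U μ h *ᵥ ψ =
      (((dWaveSourceTorusTT' L tp U μ h).groundEnergy : ℝ) : ℂ) • ψ)
    (Xw : FermionOp Λ')
    {m : Type*} [Fintype m] [DecidableEq m] {Λm : Matrix m m ℂ} (hΛm : Λm.PosSemidef)
    (O : m → FermionOp Λ')
    {κ' : Type*} (s : Finset κ') (B : κ' → FermionOp Λ)
    {ι : Type*} (tt : Finset ι) (γ : ι → DihedralGroup 4) (hγS : ∀ l ∈ tt, γ l ∈ S) (wv : ι → Site 2)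
    (hsh : ∀ l, d4ShiftSet (γ l) (wv l) Λ ⊆ Λ') (Y : ι → FermionOp Λ)
    {ρ : Type*} (uu : Finset ρ) (b : ρ → ℂ) (cw : ρ → List (Orb (PolySite Λ') × Bool))
    (hcw : ∀ j ∈ uu, ladderSpinCharge (cw j) ≠ 0)
    {δ : Type*} (ah : Finset δ) (dc : δ → ℝ) (V : δ → FermionOp Λ')
    {κ'' : Type*} (w : Finset κ'') (a : κ'' → ℂ) (word : κ'' → List (Orb (PolySite Λ') × Bool))
    {β : Type*} [Fintype β] [DecidableEq β] {G : Matrix β β ℂ} (hG : G.PosSemidef)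
    (Bk : β → FermionOp Λ) {c : ℝ}
    (hcert : Xw - (c : ℂ) • (1 : FermionOp Λ') =
      gramForm Λm O +
        (∑ k ∈ s, (pairSourceWindowHamiltonianTT' dWaveFormFactor Λ' tp U μ h * fermionEmbed (PolySite.incl hΛ) (B k) -
            fermionEmbed (PolySite.incl hΛ) (B k) * pairSourceWindowHamiltonianTT' dWaveFormFactor Λ' tp U μ h) +
          ∑ l ∈ tt, (fermionEmbed (PolySite.incl (hsh l)) (fermionEmbed (PolySite.d4Emb (γ l) (wv l) Λ) (Y l)) -
            fermionEmbed (PolySite.incl hΛ) (Y l)) +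
          ∑ j ∈ uu, b j • ladderWord (cw j)) +
        (∑ m' ∈ ah, ((dc m' : ℝ) : ℂ) • ((V m')ᴴ - V m') + ∑ k ∈ w, a k • ladderWord (word k)) +
        kktForm (pairSourceWindowHamiltonianTT' dWaveFormFactor Λ' tp U μ h) G
          (fun b' => fermionEmbed (PolySite.incl hΛ) (Bk b'))) :
    c - ∑ k ∈ w, ‖a k‖ ≤
      (orbitState (spaceGroupUnitary S) ψ (fermionEmbed (PolySite.toTorusEmb L hInj') Xw)).re := by
  have hcert' : Xw - (c : ℂ) • (1 : FermionOp Λ') -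
      (((0 : ℝ) : ℝ) : ℂ) • ((((0 : ℝ) : ℝ) : ℂ) • (1 : FermionOp Λ') -
        (fermionEmbed (PolySite.incl h0) ((hubbardTTPrimeFermionInteraction 1 tp U).meanEnergyObs 1) -
          (μ : ℂ) • ∑ σ : Fin 2, nAt 0 hz σ -
          (h : ℂ) • (fermionEmbed (PolySite.incl hP) (localPairAt (insert (0 : Site 2) unitSteps) dWaveFormFactor 0) +
            (fermionEmbed (PolySite.incl hP) (localPairAt (insert (0 : Site 2) unitSteps) dWaveFormFactor 0))ᴴ))) =
      gramForm Λm O +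
        (∑ k ∈ s, (pairSourceWindowHamiltonianTT' dWaveFormFactor Λ' tp U μ h * fermionEmbed (PolySite.incl hΛ) (B k) -
            fermionEmbed (PolySite.incl hΛ) (B k) * pairSourceWindowHamiltonianTT' dWaveFormFactor Λ' tp U μ h) +
          ∑ l ∈ tt, (fermionEmbed (PolySite.incl (hsh l)) (fermionEmbed (PolySite.d4Emb (γ l) (wv l) Λ) (Y l)) -
            fermionEmbed (PolySite.incl hΛ) (Y l)) +
          ∑ j ∈ uu, b j • ladderWord (cw j)) +
        (∑ m' ∈ ah, ((dc m' : ℝ) : ℂ) • ((V m')ᴴ - V m') + ∑ k ∈ w, a k • ladderWord (word k)) +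
        kktForm (pairSourceWindowHamiltonianTT' dWaveFormFactor Λ' tp U μ h) G
          (fun b' => fermionEmbed (PolySite.incl hΛ) (Bk b')) := by
    rw [Complex.ofReal_zero, zero_smul, sub_zero]
    exact hcert
  have hmain := re_orbitState_ge_of_sourced_window_certificate_d4_TT'_kkt_ineq tp U μ h hL hΛ h8 h0 hz hP hInj hInj'
    h1 hmul hS hψK hψ1 hHψ Xw 0 0 hΛm O s B tt γ hγS wv hsh Y uu b cw hcw ah dc V w a word hG Bk hcert'
  rw [zero_mul, add_zero] at hmain
  exact hmain

end TorusSourced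

end Literature.MathematicalPhysics.QuantumLattice

end
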